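/-
COR-CM (cell pub-hodgecm2, stage 2 of the Hodge ladder) — count-neutral KERNEL COMBINATORICS «the cyclic block numerals»
(seat prover-pub-hodgecm2-b23-g39-0, binder prover b23, gen 39; claim CYCLIC-FIELDS F2, HOME/INBOX.md l.9351).  Theorems only (kernel
arithmetic by `decide` + seat b09's closed forms BY NAME + this seat's `CorCM/FaceCyclicGeneration.lean` BY NAME); no geometry, no named
fact, nothing asserted; `Interfaces.lean` (C1), every E term, B01 and `Transposition/*` are untouched.
HONEST FRAMING (COORDINATOR RULING — HODGE FRAMING CORRECTION, 2026-08-21T11:55:35Z): `HC_CM` is NOT proved, here or anywhere in the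
tree; this file produces no period and proves no face period for any field.
T5: n/a-class — no Prop hypothesis binder beyond instance binders and numeral equations; checker: self (prover-pub-hodgecm2-b23-g39-0),
2026-08-22.
-/
import Summits.HodgeConjecture.CorCM.FaceCyclicGeneration
import HarnessLib

/-!
# The cyclic block numerals: `β = 2, 2, 4, 6, 10, 16, 30, 52, 94, 172, 316, 586, 1096` for cyclic Galois CM types of order `6, 8, …, 30`

Seat b09's closed form for a CYCLIC Galois CM type `(G, c)` (`Census/BlockParityBurnsideCyclic.lean`, `card_block_mul_card_of_isCyclic`;
field form `CorCM/FaceParityFloor.lean`, `FaceParity.card_block_mul_finrank_of_isCyclic`),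
`β(G,c)·|G| = Σ_{d ∣ |G|, d odd} φ(d)·2^{|G|/2/d}`, left the numerals «to arithmetic».  This file decides them in the kernel
(`decide` on the divisor sums, §1) and reads them at the three levels of the census programme:

* §2 GROUP LEVEL `card_block_of_card_eq_<n>`: a cyclic group `G` of order `n ∈ {6, 8, …, 30}` with an involution `c ≠ 1` has
  `β(G,c) = #Block c = 2, 2, 4, 6, 10, 16, 30, 52, 94, 172, 316, 586, 1096`;
* §3 FIELD LEVEL `card_block_galT_of_finrank_eq_<n>`: a Galois CM field `F` with CYCLIC `GalT F` (`CorCM/FaceCyclicGaloisGroup.lean`: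
  iff `Aut(F)` is cyclic; `ℚ(ζ_{p^k})`, `p` odd) and `[F:ℚ] = n` has `β(F) = ` the same numeral;
* §4 FACE LEVEL `isLeast_card_faces_hgen_of_finrank_eq_<n>` (this seat's `FaceCyclic.isLeast_card_faces_hgen_of_isCyclic`, gen 38, BY NAME):
  the least number of rank-four faces of `F` whose Weil characters at all base embeddings generate those of every face (the INT2-GEN
  binder `hgen(𝒮, σ₀)`) is EXACTLY **`β(F) − 1 = 1, 1, 3, 5, 9, 15, 29, 51, 93, 171, 315, 585, 1095`** for `[F:ℚ] = 6, 8, …, 30` — the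
  cyclic rows `ℤ/6 … ℤ/22` of André-3's atlas, b17's `1095` at `ℤ/30`, lit-andre-3's order-28 oracle `ℤ/28 ↦ 585`, and this seat's
  `CYCLIC-MU.md` (`μ(ℤ/18) = 29`, `μ(ℤ/22) = 93`, `μ_ℚ(ℤ/26) = 315`), now as kernel theorems for EVERY cyclic Galois CM field of the
  degree, census-free.

The named cyclotomic fields (`ℚ(ζ₇)`, `ℚ(ζ₉)`, `ℚ(ζ₁₁)`, `ℚ(ζ₁₃)`, `ℚ(ζ₁₉)`, `ℚ(ζ₂₃)`, `ℚ(ζ₂₅)`, `ℚ(ζ₂₇)`, `ℚ(ζ₂₉)`, `ℚ(ζ₃₁)`) are the sequel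
`CorCM/FaceCyclotomicFields.lean`.  `HC_CM` is NOT proved; no period is produced.

References: [cite: Pohlmann1968, Thm. 1]; [cite: Milne1999LefschetzClasses, Thm. 3.2, Prop. 2.1]; [cite: Shimura1998, §8.1 (p. 62)].
-/

noncomputable section

open NumberField NumberField.ComplexEmbedding

namespace Summit.HodgeConjecture.CorCM.FaceCyclic

open Summit.HodgeConjecture.CorCM.Prior.AllgGroup.RfwfAllgGroup
open Summit.HodgeConjecture.CorCM.Census.BlockParity

/-! ## §1 The divisor sums, decided -/

section Arithmetic

/-- `Σ_{d ∣ 6, d odd} φ(d)·2^{6/2/d} = 2 · 6`. [folklore] -/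
theorem blockSum_six : ∑ d ∈ (6 : ℕ).divisors with Odd d, Nat.totient d * 2 ^ (6 / 2 / d) = 2 * 6 := by decide
/-- `Σ_{d ∣ 8, d odd} φ(d)·2^{8/2/d} = 2 · 8`. [folklore] -/
theorem blockSum_eight : ∑ d ∈ (8 : ℕ).divisors with Odd d, Nat.totient d * 2 ^ (8 / 2 / d) = 2 * 8 := by decide
/-- `Σ_{d ∣ 10, d odd} φ(d)·2^{10/2/d} = 4 · 10`. [folklore] -/
theorem blockSum_ten : ∑ d ∈ (10 : ℕ).divisors with Odd d, Nat.totient d * 2 ^ (10 / 2 / d) = 4 * 10 := by decide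
/-- `Σ_{d ∣ 12, d odd} φ(d)·2^{12/2/d} = 6 · 12`. [folklore] -/
theorem blockSum_twelve : ∑ d ∈ (12 : ℕ).divisors with Odd d, Nat.totient d * 2 ^ (12 / 2 / d) = 6 * 12 := by decide
/-- `Σ_{d ∣ 14, d odd} φ(d)·2^{14/2/d} = 10 · 14`. [folklore] -/
theorem blockSum_fourteen : ∑ d ∈ (14 : ℕ).divisors with Odd d, Nat.totient d * 2 ^ (14 / 2 / d) = 10 * 14 := by decide
/-- `Σ_{d ∣ 16, d odd} φ(d)·2^{16/2/d} = 16 · 16`. [folklore] -/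
theorem blockSum_sixteen : ∑ d ∈ (16 : ℕ).divisors with Odd d, Nat.totient d * 2 ^ (16 / 2 / d) = 16 * 16 := by decide
/-- `Σ_{d ∣ 18, d odd} φ(d)·2^{18/2/d} = 30 · 18`. [folklore] -/
theorem blockSum_eighteen : ∑ d ∈ (18 : ℕ).divisors with Odd d, Nat.totient d * 2 ^ (18 / 2 / d) = 30 * 18 := by decide
/-- `Σ_{d ∣ 20, d odd} φ(d)·2^{20/2/d} = 52 · 20`. [folklore] -/
theorem blockSum_twenty : ∑ d ∈ (20 : ℕ).divisors with Odd d, Nat.totient d * 2 ^ (20 / 2 / d) = 52 * 20 := by decide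
/-- `Σ_{d ∣ 22, d odd} φ(d)·2^{22/2/d} = 94 · 22`. [folklore] -/
theorem blockSum_twentyTwo : ∑ d ∈ (22 : ℕ).divisors with Odd d, Nat.totient d * 2 ^ (22 / 2 / d) = 94 * 22 := by decide
/-- `Σ_{d ∣ 24, d odd} φ(d)·2^{24/2/d} = 172 · 24`. [folklore] -/
theorem blockSum_twentyFour : ∑ d ∈ (24 : ℕ).divisors with Odd d, Nat.totient d * 2 ^ (24 / 2 / d) = 172 * 24 := by decide
/-- `Σ_{d ∣ 26, d odd} φ(d)·2^{26/2/d} = 316 · 26`. [folklore] -/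
theorem blockSum_twentySix : ∑ d ∈ (26 : ℕ).divisors with Odd d, Nat.totient d * 2 ^ (26 / 2 / d) = 316 * 26 := by decide
/-- `Σ_{d ∣ 28, d odd} φ(d)·2^{28/2/d} = 586 · 28`. [folklore] -/
theorem blockSum_twentyEight : ∑ d ∈ (28 : ℕ).divisors with Odd d, Nat.totient d * 2 ^ (28 / 2 / d) = 586 * 28 := by decide
/-- `Σ_{d ∣ 30, d odd} φ(d)·2^{30/2/d} = 1096 · 30`. [folklore] -/
theorem blockSum_thirty : ∑ d ∈ (30 : ℕ).divisors with Odd d, Nat.totient d * 2 ^ (30 / 2 / d) = 1096 * 30 := by decide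

end Arithmetic

/-! ## §2 Group level: `β(G, c)` for a cyclic group of order `6, …, 30` -/

section GroupLevel

variable {G : Type*} [Group G] [Fintype G] [DecidableEq G] (c : G)

/-- **`β(G,c)` from the order of a cyclic `G`**: if `|G| = n` and `Σ_{d ∣ n, d odd} φ(d)·2^{n/2/d} = b·n` then `#Block c = b`
(b09's `card_block_mul_card_of_isCyclic`). [folklore] -/
theorem card_block_eq_of_card_eq [IsCyclic G] (hc2 : c * c = 1) (hc1 : c ≠ 1) {n b : ℕ} (hn : Fintype.card G = n)
    (hb : ∑ d ∈ n.divisors with Odd d, Nat.totient d * 2 ^ (n / 2 / d) = b * n) : Fintype.card (Block c) = b := by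
  have h := card_block_mul_card_of_isCyclic c hc2 hc1
  rw [hn, hb] at h
  exact Nat.eq_of_mul_eq_mul_right (hn ▸ Fintype.card_pos) h

/-- **`ℤ/6`**: a cyclic group of order `6` with an involution `c ≠ 1` has `β = 2` blocks of CM types. [folklore] -/
theorem card_block_of_card_eq_six [IsCyclic G] (hc2 : c * c = 1) (hc1 : c ≠ 1) (h : Fintype.card G = 6) :
    Fintype.card (Block c) = 2 :=
  card_block_eq_of_card_eq c hc2 hc1 h blockSum_six

/-- **`ℤ/8`**: a cyclic group of order `8` with an involution `c ≠ 1` has `β = 2` blocks of CM types. [folklore] -/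
theorem card_block_of_card_eq_eight [IsCyclic G] (hc2 : c * c = 1) (hc1 : c ≠ 1) (h : Fintype.card G = 8) :
    Fintype.card (Block c) = 2 :=
  card_block_eq_of_card_eq c hc2 hc1 h blockSum_eight

/-- **`ℤ/10`**: a cyclic group of order `10` with an involution `c ≠ 1` has `β = 4` blocks of CM types. [folklore] -/
theorem card_block_of_card_eq_ten [IsCyclic G] (hc2 : c * c = 1) (hc1 : c ≠ 1) (h : Fintype.card G = 10) :
    Fintype.card (Block c) = 4 :=
  card_block_eq_of_card_eq c hc2 hc1 h blockSum_ten

/-- **`ℤ/12`**: a cyclic group of order `12` with an involution `c ≠ 1` has `β = 6` blocks of CM types. [folklore] -/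
theorem card_block_of_card_eq_twelve [IsCyclic G] (hc2 : c * c = 1) (hc1 : c ≠ 1) (h : Fintype.card G = 12) :
    Fintype.card (Block c) = 6 :=
  card_block_eq_of_card_eq c hc2 hc1 h blockSum_twelve

/-- **`ℤ/14`**: a cyclic group of order `14` with an involution `c ≠ 1` has `β = 10` blocks of CM types. [folklore] -/
theorem card_block_of_card_eq_fourteen [IsCyclic G] (hc2 : c * c = 1) (hc1 : c ≠ 1) (h : Fintype.card G = 14) :
    Fintype.card (Block c) = 10 :=
  card_block_eq_of_card_eq c hc2 hc1 h blockSum_fourteen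

/-- **`ℤ/16`**: a cyclic group of order `16` with an involution `c ≠ 1` has `β = 16` blocks of CM types. [folklore] -/
theorem card_block_of_card_eq_sixteen [IsCyclic G] (hc2 : c * c = 1) (hc1 : c ≠ 1) (h : Fintype.card G = 16) :
    Fintype.card (Block c) = 16 :=
  card_block_eq_of_card_eq c hc2 hc1 h blockSum_sixteen

/-- **`ℤ/18`**: a cyclic group of order `18` with an involution `c ≠ 1` has `β = 30` blocks of CM types. [folklore] -/
theorem card_block_of_card_eq_eighteen [IsCyclic G] (hc2 : c * c = 1) (hc1 : c ≠ 1) (h : Fintype.card G = 18) :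
    Fintype.card (Block c) = 30 :=
  card_block_eq_of_card_eq c hc2 hc1 h blockSum_eighteen

/-- **`ℤ/20`**: a cyclic group of order `20` with an involution `c ≠ 1` has `β = 52` blocks of CM types. [folklore] -/
theorem card_block_of_card_eq_twenty [IsCyclic G] (hc2 : c * c = 1) (hc1 : c ≠ 1) (h : Fintype.card G = 20) :
    Fintype.card (Block c) = 52 :=
  card_block_eq_of_card_eq c hc2 hc1 h blockSum_twenty

/-- **`ℤ/22`**: a cyclic group of order `22` with an involution `c ≠ 1` has `β = 94` blocks of CM types. [folklore] -/
theorem card_block_of_card_eq_twentyTwo [IsCyclic G] (hc2 : c * c = 1) (hc1 : c ≠ 1) (h : Fintype.card G = 22) :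
    Fintype.card (Block c) = 94 :=
  card_block_eq_of_card_eq c hc2 hc1 h blockSum_twentyTwo

/-- **`ℤ/24`**: a cyclic group of order `24` with an involution `c ≠ 1` has `β = 172` blocks of CM types. [folklore] -/
theorem card_block_of_card_eq_twentyFour [IsCyclic G] (hc2 : c * c = 1) (hc1 : c ≠ 1) (h : Fintype.card G = 24) :
    Fintype.card (Block c) = 172 :=
  card_block_eq_of_card_eq c hc2 hc1 h blockSum_twentyFour

/-- **`ℤ/26`**: a cyclic group of order `26` with an involution `c ≠ 1` has `β = 316` blocks of CM types. [folklore] -/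
theorem card_block_of_card_eq_twentySix [IsCyclic G] (hc2 : c * c = 1) (hc1 : c ≠ 1) (h : Fintype.card G = 26) :
    Fintype.card (Block c) = 316 :=
  card_block_eq_of_card_eq c hc2 hc1 h blockSum_twentySix

/-- **`ℤ/28`**: a cyclic group of order `28` with an involution `c ≠ 1` has `β = 586` blocks of CM types. [folklore] -/
theorem card_block_of_card_eq_twentyEight [IsCyclic G] (hc2 : c * c = 1) (hc1 : c ≠ 1) (h : Fintype.card G = 28) :
    Fintype.card (Block c) = 586 :=
  card_block_eq_of_card_eq c hc2 hc1 h blockSum_twentyEight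

/-- **`ℤ/30`**: a cyclic group of order `30` with an involution `c ≠ 1` has `β = 1096` blocks of CM types. [folklore] -/
theorem card_block_of_card_eq_thirty [IsCyclic G] (hc2 : c * c = 1) (hc1 : c ≠ 1) (h : Fintype.card G = 30) :
    Fintype.card (Block c) = 1096 :=
  card_block_eq_of_card_eq c hc2 hc1 h blockSum_thirty

end GroupLevel

/-! ## §3 Field level: `β(F)` for a Galois CM field with cyclic `GalT F` of degree `6, …, 30` -/

section FieldLevel

variable {F : Type} [Field F] [NumberField F]

/-- **`β(F)` from the degree of a cyclic Galois CM field**: if `[F:ℚ] = n` and `Σ_{d ∣ n, d odd} φ(d)·2^{n/2/d} = b·n` then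
`#Block conjT = b` (b09's `FaceParity.card_block_mul_finrank_of_isCyclic`). [folklore] -/
theorem card_block_galT_eq_of_finrank_eq [IsCMField F] [IsGalois ℚ F] [IsCyclic (GalT F)] {n b : ℕ} (hn : Module.finrank ℚ F = n)
    (hb : ∑ d ∈ n.divisors with Odd d, Nat.totient d * 2 ^ (n / 2 / d) = b * n) :
    Fintype.card (Block (conjT : GalT F)) = b := by
  have h := FaceParity.card_block_mul_finrank_of_isCyclic (F := F)
  rw [hn, hb] at h
  exact Nat.eq_of_mul_eq_mul_right (hn ▸ Module.finrank_pos) h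

/-- **Cyclic Galois CM fields of degree `6`** (`ℤ/6`: `ℚ(ζ₇)`, `ℚ(ζ₉)`, every cyclic sextic CM field): `β(F) = 2`. [folklore] -/
theorem card_block_galT_of_finrank_eq_six [IsCMField F] [IsGalois ℚ F] [IsCyclic (GalT F)]
    (h : Module.finrank ℚ F = 6) : Fintype.card (Block (conjT : GalT F)) = 2 :=
  card_block_galT_eq_of_finrank_eq h blockSum_six

/-- **Cyclic Galois CM fields of degree `8`** (`ℤ/8`: the degree-`8` CM subfield of `ℚ(ζ₄₁)`): `β(F) = 2`. [folklore] -/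
theorem card_block_galT_of_finrank_eq_eight [IsCMField F] [IsGalois ℚ F] [IsCyclic (GalT F)]
    (h : Module.finrank ℚ F = 8) : Fintype.card (Block (conjT : GalT F)) = 2 :=
  card_block_galT_eq_of_finrank_eq h blockSum_eight

/-- **Cyclic Galois CM fields of degree `10`** (`ℤ/10`: `ℚ(ζ₁₁)`): `β(F) = 4`. [folklore] -/
theorem card_block_galT_of_finrank_eq_ten [IsCMField F] [IsGalois ℚ F] [IsCyclic (GalT F)]
    (h : Module.finrank ℚ F = 10) : Fintype.card (Block (conjT : GalT F)) = 4 :=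
  card_block_galT_eq_of_finrank_eq h blockSum_ten

/-- **Cyclic Galois CM fields of degree `12`** (`ℤ/12`: `ℚ(ζ₁₃)`): `β(F) = 6`. [folklore] -/
theorem card_block_galT_of_finrank_eq_twelve [IsCMField F] [IsGalois ℚ F] [IsCyclic (GalT F)]
    (h : Module.finrank ℚ F = 12) : Fintype.card (Block (conjT : GalT F)) = 6 :=
  card_block_galT_eq_of_finrank_eq h blockSum_twelve

/-- **Cyclic Galois CM fields of degree `14`** (`ℤ/14`: the degree-`14` CM subfields of `ℚ(ζ₄₃)`, `ℚ(ζ₇₁)`): `β(F) = 10`. [folklore] -/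
theorem card_block_galT_of_finrank_eq_fourteen [IsCMField F] [IsGalois ℚ F] [IsCyclic (GalT F)]
    (h : Module.finrank ℚ F = 14) : Fintype.card (Block (conjT : GalT F)) = 10 :=
  card_block_galT_eq_of_finrank_eq h blockSum_fourteen

/-- **Cyclic Galois CM fields of degree `16`** (`ℤ/16`: `ℚ(ζ₁₇)`): `β(F) = 16`. [folklore] -/
theorem card_block_galT_of_finrank_eq_sixteen [IsCMField F] [IsGalois ℚ F] [IsCyclic (GalT F)]
    (h : Module.finrank ℚ F = 16) : Fintype.card (Block (conjT : GalT F)) = 16 :=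
  card_block_galT_eq_of_finrank_eq h blockSum_sixteen

/-- **Cyclic Galois CM fields of degree `18`** (`ℤ/18`: `ℚ(ζ₁₉)`, `ℚ(ζ₂₇)`): `β(F) = 30`. [folklore] -/
theorem card_block_galT_of_finrank_eq_eighteen [IsCMField F] [IsGalois ℚ F] [IsCyclic (GalT F)]
    (h : Module.finrank ℚ F = 18) : Fintype.card (Block (conjT : GalT F)) = 30 :=
  card_block_galT_eq_of_finrank_eq h blockSum_eighteen

/-- **Cyclic Galois CM fields of degree `20`** (`ℤ/20`: `ℚ(ζ₂₅)`, the degree-`20` CM subfield of `ℚ(ζ₆₁)`): `β(F) = 52`. [folklore] -/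
theorem card_block_galT_of_finrank_eq_twenty [IsCMField F] [IsGalois ℚ F] [IsCyclic (GalT F)]
    (h : Module.finrank ℚ F = 20) : Fintype.card (Block (conjT : GalT F)) = 52 :=
  card_block_galT_eq_of_finrank_eq h blockSum_twenty

/-- **Cyclic Galois CM fields of degree `22`** (`ℤ/22`: `ℚ(ζ₂₃)`): `β(F) = 94`. [folklore] -/
theorem card_block_galT_of_finrank_eq_twentyTwo [IsCMField F] [IsGalois ℚ F] [IsCyclic (GalT F)]
    (h : Module.finrank ℚ F = 22) : Fintype.card (Block (conjT : GalT F)) = 94 :=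
  card_block_galT_eq_of_finrank_eq h blockSum_twentyTwo

/-- **Cyclic Galois CM fields of degree `24`** (`ℤ/24`: the degree-`24` CM subfield of `ℚ(ζ₇₃)`): `β(F) = 172`. [folklore] -/
theorem card_block_galT_of_finrank_eq_twentyFour [IsCMField F] [IsGalois ℚ F] [IsCyclic (GalT F)]
    (h : Module.finrank ℚ F = 24) : Fintype.card (Block (conjT : GalT F)) = 172 :=
  card_block_galT_eq_of_finrank_eq h blockSum_twentyFour

/-- **Cyclic Galois CM fields of degree `26`** (`ℤ/26`: the degree-`26` CM subfield of `ℚ(ζ₇₉)`): `β(F) = 316`. [folklore] -/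
theorem card_block_galT_of_finrank_eq_twentySix [IsCMField F] [IsGalois ℚ F] [IsCyclic (GalT F)]
    (h : Module.finrank ℚ F = 26) : Fintype.card (Block (conjT : GalT F)) = 316 :=
  card_block_galT_eq_of_finrank_eq h blockSum_twentySix

/-- **Cyclic Galois CM fields of degree `28`** (`ℤ/28`: `ℚ(ζ₂₉)`): `β(F) = 586`. [folklore] -/
theorem card_block_galT_of_finrank_eq_twentyEight [IsCMField F] [IsGalois ℚ F] [IsCyclic (GalT F)]
    (h : Module.finrank ℚ F = 28) : Fintype.card (Block (conjT : GalT F)) = 586 :=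
  card_block_galT_eq_of_finrank_eq h blockSum_twentyEight

/-- **Cyclic Galois CM fields of degree `30`** (`ℤ/30`: `ℚ(ζ₃₁)`): `β(F) = 1096`. [folklore] -/
theorem card_block_galT_of_finrank_eq_thirty [IsCMField F] [IsGalois ℚ F] [IsCyclic (GalT F)]
    (h : Module.finrank ℚ F = 30) : Fintype.card (Block (conjT : GalT F)) = 1096 :=
  card_block_galT_eq_of_finrank_eq h blockSum_thirty

/-! ## §4 Face level: the least number of generating faces is `β(F) − 1` -/

/-- **The least size of an `hgen` face set from `β(F)`**: if `#Block conjT = b` then the least `|𝒮|` with `hgen(𝒮, σ₀)` is `b − 1`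
(this seat's `isLeast_card_faces_hgen_of_isCyclic`, gen 38). [folklore] -/
theorem isLeast_card_faces_hgen_of_card_block_eq [IsCMField F] [IsGalois ℚ F] [IsCyclic (GalT F)] {b : ℕ}
    (hβ : Fintype.card (Block (conjT : GalT F)) = b) (σ₀ : F →+* ℂ) :
    IsLeast {m : ℕ | ∃ 𝒮 : Finset (Face F), 𝒮.card = m ∧
      ∀ f : Face F, lefChar f.corner (fun _ => ({σ₀} : Finset (F →+* ℂ))) ∈ AddSubgroup.closure
        {a : Asym F | ∃ g ∈ (𝒮 : Set (Face F)), ∃ σ : F →+* ℂ, a = lefChar g.corner (fun _ => ({σ} : Finset (F →+* ℂ)))}}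
      (b - 1) := by
  rw [← hβ]
  exact isLeast_card_faces_hgen_of_isCyclic σ₀

/-- **An `hgen` face set of size exactly `β(F) − 1` exists**: numeral form of `exists_faces_hgen_of_isCyclic`. [folklore] -/
theorem exists_faces_hgen_card_eq_of_card_block_eq [IsCMField F] [IsGalois ℚ F] [IsCyclic (GalT F)] {b : ℕ}
    (hβ : Fintype.card (Block (conjT : GalT F)) = b) (σ₀ : F →+* ℂ) :
    ∃ 𝒮 : Finset (Face F), 𝒮.card = b - 1 ∧
      ∀ f : Face F, lefChar f.corner (fun _ => ({σ₀} : Finset (F →+* ℂ))) ∈ AddSubgroup.closure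
        {a : Asym F | ∃ g ∈ (𝒮 : Set (Face F)), ∃ σ : F →+* ℂ, a = lefChar g.corner (fun _ => ({σ} : Finset (F →+* ℂ)))} := by
  obtain ⟨𝒮, hcard, hgen⟩ := exists_faces_hgen_of_isCyclic (F := F) σ₀
  exact ⟨𝒮, by omega, hgen⟩

/-- **Cyclic Galois CM fields of degree `6`: EXACTLY `1` generating face, none fewer** — the least size of a face set `𝒮`
with `hgen(𝒮, σ₀)` is `1`, for every such field and every base embedding. [folklore] -/
theorem isLeast_card_faces_hgen_of_finrank_eq_six [IsCMField F] [IsGalois ℚ F] [IsCyclic (GalT F)]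
    (h : Module.finrank ℚ F = 6) (σ₀ : F →+* ℂ) :
    IsLeast {m : ℕ | ∃ 𝒮 : Finset (Face F), 𝒮.card = m ∧
      ∀ f : Face F, lefChar f.corner (fun _ => ({σ₀} : Finset (F →+* ℂ))) ∈ AddSubgroup.closure
        {a : Asym F | ∃ g ∈ (𝒮 : Set (Face F)), ∃ σ : F →+* ℂ, a = lefChar g.corner (fun _ => ({σ} : Finset (F →+* ℂ)))}}
      1 :=
  isLeast_card_faces_hgen_of_card_block_eq (card_block_galT_of_finrank_eq_six h) σ₀

/-- **Cyclic Galois CM fields of degree `8`: EXACTLY `1` generating face, none fewer** — the least size of a face set `𝒮`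
with `hgen(𝒮, σ₀)` is `1`, for every such field and every base embedding. [folklore] -/
theorem isLeast_card_faces_hgen_of_finrank_eq_eight [IsCMField F] [IsGalois ℚ F] [IsCyclic (GalT F)]
    (h : Module.finrank ℚ F = 8) (σ₀ : F →+* ℂ) :
    IsLeast {m : ℕ | ∃ 𝒮 : Finset (Face F), 𝒮.card = m ∧
      ∀ f : Face F, lefChar f.corner (fun _ => ({σ₀} : Finset (F →+* ℂ))) ∈ AddSubgroup.closure
        {a : Asym F | ∃ g ∈ (𝒮 : Set (Face F)), ∃ σ : F →+* ℂ, a = lefChar g.corner (fun _ => ({σ} : Finset (F →+* ℂ)))}}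
      1 :=
  isLeast_card_faces_hgen_of_card_block_eq (card_block_galT_of_finrank_eq_eight h) σ₀

/-- **Cyclic Galois CM fields of degree `10`: EXACTLY `3` generating faces, none fewer** — the least size of a face set `𝒮`
with `hgen(𝒮, σ₀)` is `3`, for every such field and every base embedding. [folklore] -/
theorem isLeast_card_faces_hgen_of_finrank_eq_ten [IsCMField F] [IsGalois ℚ F] [IsCyclic (GalT F)]
    (h : Module.finrank ℚ F = 10) (σ₀ : F →+* ℂ) :
    IsLeast {m : ℕ | ∃ 𝒮 : Finset (Face F), 𝒮.card = m ∧
      ∀ f : Face F, lefChar f.corner (fun _ => ({σ₀} : Finset (F →+* ℂ))) ∈ AddSubgroup.closure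
        {a : Asym F | ∃ g ∈ (𝒮 : Set (Face F)), ∃ σ : F →+* ℂ, a = lefChar g.corner (fun _ => ({σ} : Finset (F →+* ℂ)))}}
      3 :=
  isLeast_card_faces_hgen_of_card_block_eq (card_block_galT_of_finrank_eq_ten h) σ₀

/-- **Cyclic Galois CM fields of degree `12`: EXACTLY `5` generating faces, none fewer** — the least size of a face set `𝒮`
with `hgen(𝒮, σ₀)` is `5`, for every such field and every base embedding. [folklore] -/
theorem isLeast_card_faces_hgen_of_finrank_eq_twelve [IsCMField F] [IsGalois ℚ F] [IsCyclic (GalT F)]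
    (h : Module.finrank ℚ F = 12) (σ₀ : F →+* ℂ) :
    IsLeast {m : ℕ | ∃ 𝒮 : Finset (Face F), 𝒮.card = m ∧
      ∀ f : Face F, lefChar f.corner (fun _ => ({σ₀} : Finset (F →+* ℂ))) ∈ AddSubgroup.closure
        {a : Asym F | ∃ g ∈ (𝒮 : Set (Face F)), ∃ σ : F →+* ℂ, a = lefChar g.corner (fun _ => ({σ} : Finset (F →+* ℂ)))}}
      5 :=
  isLeast_card_faces_hgen_of_card_block_eq (card_block_galT_of_finrank_eq_twelve h) σ₀

/-- **Cyclic Galois CM fields of degree `14`: EXACTLY `9` generating faces, none fewer** — the least size of a face set `𝒮`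
with `hgen(𝒮, σ₀)` is `9`, for every such field and every base embedding. [folklore] -/
theorem isLeast_card_faces_hgen_of_finrank_eq_fourteen [IsCMField F] [IsGalois ℚ F] [IsCyclic (GalT F)]
    (h : Module.finrank ℚ F = 14) (σ₀ : F →+* ℂ) :
    IsLeast {m : ℕ | ∃ 𝒮 : Finset (Face F), 𝒮.card = m ∧
      ∀ f : Face F, lefChar f.corner (fun _ => ({σ₀} : Finset (F →+* ℂ))) ∈ AddSubgroup.closure
        {a : Asym F | ∃ g ∈ (𝒮 : Set (Face F)), ∃ σ : F →+* ℂ, a = lefChar g.corner (fun _ => ({σ} : Finset (F →+* ℂ)))}}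
      9 :=
  isLeast_card_faces_hgen_of_card_block_eq (card_block_galT_of_finrank_eq_fourteen h) σ₀

/-- **Cyclic Galois CM fields of degree `16`: EXACTLY `15` generating faces, none fewer** — the least size of a face set `𝒮`
with `hgen(𝒮, σ₀)` is `15`, for every such field and every base embedding. [folklore] -/
theorem isLeast_card_faces_hgen_of_finrank_eq_sixteen [IsCMField F] [IsGalois ℚ F] [IsCyclic (GalT F)]
    (h : Module.finrank ℚ F = 16) (σ₀ : F →+* ℂ) :
    IsLeast {m : ℕ | ∃ 𝒮 : Finset (Face F), 𝒮.card = m ∧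
      ∀ f : Face F, lefChar f.corner (fun _ => ({σ₀} : Finset (F →+* ℂ))) ∈ AddSubgroup.closure
        {a : Asym F | ∃ g ∈ (𝒮 : Set (Face F)), ∃ σ : F →+* ℂ, a = lefChar g.corner (fun _ => ({σ} : Finset (F →+* ℂ)))}}
      15 :=
  isLeast_card_faces_hgen_of_card_block_eq (card_block_galT_of_finrank_eq_sixteen h) σ₀

/-- **Cyclic Galois CM fields of degree `18`: EXACTLY `29` generating faces, none fewer** — the least size of a face set `𝒮`
with `hgen(𝒮, σ₀)` is `29`, for every such field and every base embedding. [folklore] -/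
theorem isLeast_card_faces_hgen_of_finrank_eq_eighteen [IsCMField F] [IsGalois ℚ F] [IsCyclic (GalT F)]
    (h : Module.finrank ℚ F = 18) (σ₀ : F →+* ℂ) :
    IsLeast {m : ℕ | ∃ 𝒮 : Finset (Face F), 𝒮.card = m ∧
      ∀ f : Face F, lefChar f.corner (fun _ => ({σ₀} : Finset (F →+* ℂ))) ∈ AddSubgroup.closure
        {a : Asym F | ∃ g ∈ (𝒮 : Set (Face F)), ∃ σ : F →+* ℂ, a = lefChar g.corner (fun _ => ({σ} : Finset (F →+* ℂ)))}}
      29 :=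
  isLeast_card_faces_hgen_of_card_block_eq (card_block_galT_of_finrank_eq_eighteen h) σ₀

/-- **Cyclic Galois CM fields of degree `20`: EXACTLY `51` generating faces, none fewer** — the least size of a face set `𝒮`
with `hgen(𝒮, σ₀)` is `51`, for every such field and every base embedding. [folklore] -/
theorem isLeast_card_faces_hgen_of_finrank_eq_twenty [IsCMField F] [IsGalois ℚ F] [IsCyclic (GalT F)]
    (h : Module.finrank ℚ F = 20) (σ₀ : F →+* ℂ) :
    IsLeast {m : ℕ | ∃ 𝒮 : Finset (Face F), 𝒮.card = m ∧
      ∀ f : Face F, lefChar f.corner (fun _ => ({σ₀} : Finset (F →+* ℂ))) ∈ AddSubgroup.closure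
        {a : Asym F | ∃ g ∈ (𝒮 : Set (Face F)), ∃ σ : F →+* ℂ, a = lefChar g.corner (fun _ => ({σ} : Finset (F →+* ℂ)))}}
      51 :=
  isLeast_card_faces_hgen_of_card_block_eq (card_block_galT_of_finrank_eq_twenty h) σ₀

/-- **Cyclic Galois CM fields of degree `22`: EXACTLY `93` generating faces, none fewer** — the least size of a face set `𝒮`
with `hgen(𝒮, σ₀)` is `93`, for every such field and every base embedding. [folklore] -/
theorem isLeast_card_faces_hgen_of_finrank_eq_twentyTwo [IsCMField F] [IsGalois ℚ F] [IsCyclic (GalT F)]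
    (h : Module.finrank ℚ F = 22) (σ₀ : F →+* ℂ) :
    IsLeast {m : ℕ | ∃ 𝒮 : Finset (Face F), 𝒮.card = m ∧
      ∀ f : Face F, lefChar f.corner (fun _ => ({σ₀} : Finset (F →+* ℂ))) ∈ AddSubgroup.closure
        {a : Asym F | ∃ g ∈ (𝒮 : Set (Face F)), ∃ σ : F →+* ℂ, a = lefChar g.corner (fun _ => ({σ} : Finset (F →+* ℂ)))}}
      93 :=
  isLeast_card_faces_hgen_of_card_block_eq (card_block_galT_of_finrank_eq_twentyTwo h) σ₀

/-- **Cyclic Galois CM fields of degree `24`: EXACTLY `171` generating faces, none fewer** — the least size of a face set `𝒮`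
with `hgen(𝒮, σ₀)` is `171`, for every such field and every base embedding. [folklore] -/
theorem isLeast_card_faces_hgen_of_finrank_eq_twentyFour [IsCMField F] [IsGalois ℚ F] [IsCyclic (GalT F)]
    (h : Module.finrank ℚ F = 24) (σ₀ : F →+* ℂ) :
    IsLeast {m : ℕ | ∃ 𝒮 : Finset (Face F), 𝒮.card = m ∧
      ∀ f : Face F, lefChar f.corner (fun _ => ({σ₀} : Finset (F →+* ℂ))) ∈ AddSubgroup.closure
        {a : Asym F | ∃ g ∈ (𝒮 : Set (Face F)), ∃ σ : F →+* ℂ, a = lefChar g.corner (fun _ => ({σ} : Finset (F →+* ℂ)))}}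
      171 :=
  isLeast_card_faces_hgen_of_card_block_eq (card_block_galT_of_finrank_eq_twentyFour h) σ₀

/-- **Cyclic Galois CM fields of degree `26`: EXACTLY `315` generating faces, none fewer** — the least size of a face set `𝒮`
with `hgen(𝒮, σ₀)` is `315`, for every such field and every base embedding. [folklore] -/
theorem isLeast_card_faces_hgen_of_finrank_eq_twentySix [IsCMField F] [IsGalois ℚ F] [IsCyclic (GalT F)]
    (h : Module.finrank ℚ F = 26) (σ₀ : F →+* ℂ) :
    IsLeast {m : ℕ | ∃ 𝒮 : Finset (Face F), 𝒮.card = m ∧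
      ∀ f : Face F, lefChar f.corner (fun _ => ({σ₀} : Finset (F →+* ℂ))) ∈ AddSubgroup.closure
        {a : Asym F | ∃ g ∈ (𝒮 : Set (Face F)), ∃ σ : F →+* ℂ, a = lefChar g.corner (fun _ => ({σ} : Finset (F →+* ℂ)))}}
      315 :=
  isLeast_card_faces_hgen_of_card_block_eq (card_block_galT_of_finrank_eq_twentySix h) σ₀

/-- **Cyclic Galois CM fields of degree `28`: EXACTLY `585` generating faces, none fewer** — the least size of a face set `𝒮`
with `hgen(𝒮, σ₀)` is `585`, for every such field and every base embedding. [folklore] -/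
theorem isLeast_card_faces_hgen_of_finrank_eq_twentyEight [IsCMField F] [IsGalois ℚ F] [IsCyclic (GalT F)]
    (h : Module.finrank ℚ F = 28) (σ₀ : F →+* ℂ) :
    IsLeast {m : ℕ | ∃ 𝒮 : Finset (Face F), 𝒮.card = m ∧
      ∀ f : Face F, lefChar f.corner (fun _ => ({σ₀} : Finset (F →+* ℂ))) ∈ AddSubgroup.closure
        {a : Asym F | ∃ g ∈ (𝒮 : Set (Face F)), ∃ σ : F →+* ℂ, a = lefChar g.corner (fun _ => ({σ} : Finset (F →+* ℂ)))}}
      585 :=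
  isLeast_card_faces_hgen_of_card_block_eq (card_block_galT_of_finrank_eq_twentyEight h) σ₀

/-- **Cyclic Galois CM fields of degree `30`: EXACTLY `1095` generating faces, none fewer** — the least size of a face set `𝒮`
with `hgen(𝒮, σ₀)` is `1095`, for every such field and every base embedding. [folklore] -/
theorem isLeast_card_faces_hgen_of_finrank_eq_thirty [IsCMField F] [IsGalois ℚ F] [IsCyclic (GalT F)]
    (h : Module.finrank ℚ F = 30) (σ₀ : F →+* ℂ) :
    IsLeast {m : ℕ | ∃ 𝒮 : Finset (Face F), 𝒮.card = m ∧
      ∀ f : Face F, lefChar f.corner (fun _ => ({σ₀} : Finset (F →+* ℂ))) ∈ AddSubgroup.closure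
        {a : Asym F | ∃ g ∈ (𝒮 : Set (Face F)), ∃ σ : F →+* ℂ, a = lefChar g.corner (fun _ => ({σ} : Finset (F →+* ℂ)))}}
      1095 :=
  isLeast_card_faces_hgen_of_card_block_eq (card_block_galT_of_finrank_eq_thirty h) σ₀

end FieldLevel

end Summit.HodgeConjecture.CorCM.FaceCyclic

end
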